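import Summits.QuantumFields.YangMills.Theorems.BalabanUVNodesN10EntryLettersOfN06RecordFace
import Literature.MathematicalPhysics.QuantumFieldTheory.Balaban1983to89.B13AccretiveOfRealCoercive

/-!
# BalabanUVNodes ∕ N10 ([B13], `Dag.B13_main`) ← N06 ([B9], `Dag.B9_main`): NODE A's REAL-SLICE LETTER FOR THE INVERSE PIECE AT N06's RECORD FACE
# WITH THE COMPLEX ACCRETIVITY MARGIN DERIVED FROM PRINT's REAL LOWER BOUND (file B of module 55; module 56B)

Track A of `YM-PLAN.md` (cell `pub-ymgap`, HUMAN RULING D-0062), DAG in-edge **N06 → N10**; seat `pub-ymgap-dag-n10-c` g12.  A HELPER for the N10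
real-slice junction editions (`…N10AtRecord11B13WalksBlockRealSlice`, `…N10B13KernelTowerWalksRealSlice`) — sibling of
`BalabanUVNodesN10EntryLettersOfN06RecordFace` §2 (`rawEntryLetters_inv_at_member_realSlice`, module 55B; that file is at 376∕400 lines, so the
sibling lives here).

WHAT.  Module 55B §2 derives node N10's real-slice entry letter for the complexified inverse piece `u ↦ A(u)⁻¹` (`A` = the complexified `Δ_a`,
which at every REAL configuration `v` of the chart IS `M((𝔬A x).Δa (Uv v))` along a real family `Uv` valued in the class (3.35)) from N06's
displayed Theorem-3.10 schemas `hc35 q hq H 𝔬A κA hstA hκA h36A` VERBATIM — but it DISPLAYS, besides the holomorphy `hA` of `A` on the complex ball,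
the pair `hmA : 0 < m_A`, `hacc : ∀ u ∈ ball 0 R_an, m_A·Σ|w_i|² ≤ Re Σ w̄_i(A(u)w)_i`: an accretivity margin of the complexified operator on the WHOLE
complex ball, which is nobody's theorem and not a printed statement.  Print DERIVES it: [B9] p. 395 ∕ Thm 3.11 p. 416 (Δ_a positive definite at real
backgrounds), p. 428 («a positive definite operator C\*Δ_kC with a lower bound γ₀ > 0 independent of k and U … for an arbitrary configuration U satisfying
(3.35), (3.36) with Mα₀ sufficiently small»), Thm 3.4 p. 400 + Sect. B (3.62)–(3.64) («small perturbations of the operators depending on U only»), [II]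
p. 15 («the general case is handled by a perturbative argument»).  THIS FILE replaces `hmA ∕ hacc` by
(i) `hcoer : ∀ v ∈ ℛ.Ereal, ‖v‖ < R_an → QGQInverse.Coercive (LinearMap.toMatrix' ((𝔬A x).Δa (Uv v))) γ` — the REAL lower bound of `Δ_a` over the
class (3.35), displayed in N06's currency like `h36A` (N06's lane; nothing of it proved here), and
(ii) a majorant `Mx` of the complexified `A` on the complex ball with absolute row ∕ column sums `≤ S` (the [II] p. 15 ∕ [I] p. 263 in-edge — the same
class (C) as the displayed `hA`), plus the thin radius `R₁ ≤ R_an` with `2S·R₁∕R_an ≤ γ∕2`;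
the margin `γ∕2` on `‖u‖ < R₁` is then the THEOREM `B13AccretiveOfRealCoercive.accretive_ball_of_realCoercive` (Schwarz lemma), and 55B §2 is called
once at radius `R₁`.
* ★★ `rawEntryLetters_inv_at_member_realCoercive` — conclusion = 55B §2's at radius `R₁` with `m_A := γ∕2` (constant `B^{1−λ}(max B (4∕γ))^{λ}`).
* ★ `rawEntryLetters_inv_at_member_realCoercive_radii` — the consumer's radius `R₀` literally (`2R₀ < R₁ ≤ R_an`), rate loss `λ ≤ (4∕π)R₀∕(R₁−R₀)`.
A2 ∕ A6.  N06's schema block is N06's (displayed verbatim, inhabited or not by N06's certificate — exactly as in 55B, ref-I READ-289 A6 clean); the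
analytic block added here (holomorphy + majorant with row∕column sums + real coercivity on the slice + thin radius + real-slice decay of the inverse)
is jointly inhabited WITH GENUINE `u`-DEPENDENCE by `B13AccretiveOfRealCoercive.rawEntryLetters_inv_of_realCoercive_toy` (module 56A §5).
HONEST FRAMING.  Kernel bookkeeping; COUNT-NEUTRAL; nothing of [B9] or [II] asserted: Theorem 3.10 for `G(U)` and the real lower bound of `Δ_a` remain
N06's displayed content (GAPS G-B9-05∕06a∕07), the reading `loc ∕ sℓ ∕ ℓmax` is NODE 00's dictionary, the complexification (`ℛ Uv hUv Aop hslice hA hMx`)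
is the [II] p. 15 in-edge; dag-n10-d's ₁₃ pin algebra untouched.  NEITHER N06 NOR N10 IS DISCHARGED.  One finite 𝕋⁴ programme at fixed `ε` — NOT
continuum, NOT OS, NOT the mass gap ∕ Clay.  0 `def`, 0 `sorry`, standard axioms.
-/

noncomputable section

namespace Summit.QuantumFields.YangMills.BalabanUVNodes.N10EntryLettersOfN06RecordFaceB

open Metric Set Finset
open scoped Matrix
open Literature.MathematicalPhysics.QuantumFieldTheory.Balaban1983to89
open Literature.MathematicalPhysics.QuantumFieldTheory.Balaban1983to89.B6RandomWalk (Ineq261)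
open Literature.MathematicalPhysics.QuantumFieldTheory.Balaban1983to89.B9Thm34Ext (toB6)
open Literature.MathematicalPhysics.QuantumFieldTheory.Balaban1983to89.B9Thm37GlueTorus (tdist1)
open Literature.MathematicalPhysics.QuantumFieldTheory.Balaban1983to89.B5TorusCover (UT)
open Literature.MathematicalPhysics.QuantumFieldTheory.Balaban1983to89.B9Thm310Whole
  (Ops310 StaticOK310 Sizes310 Local342G Identities310)
open Literature.MathematicalPhysics.QuantumFieldTheory.Balaban1983to89.B9RWSumsDefinitePins (PinPrims)
open Literature.MathematicalPhysics.QuantumFieldTheory.Balaban1983to89.B9RWSums347DefiniteFaces (exp261)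
open Literature.MathematicalPhysics.QuantumFieldTheory.Balaban1983to89.B9PinMembersKLevelV1 (MemberY geo9Y)
open Literature.MathematicalPhysics.QuantumFieldTheory.Balaban1983to89.B13EntrywiseWalks (RawEntryLetters)
open Literature.MathematicalPhysics.QuantumFieldTheory.Balaban1983to89.B13RealSliceEntryLetters (RealStructure lam lam_radii_le)
open Literature.MathematicalPhysics.QuantumFieldTheory.Balaban1983to89.B13AccretiveOfRealCoercive (accretive_ball_of_realCoercive)
open Summit.QuantumFields.YangMills.BalabanUVNodes.N10EntryLettersOfN06RecordFace (rawEntryLetters_inv_at_member_realSlice)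

variable {d ℓ : ℕ} {hd : 1 ≤ d + 1} {hL : Odd (ℓ + 1) ∧ 1 < ℓ + 1} {b₀ b₁ : ℝ} {Mstar : ℕ}
variable [∀ x : MemberY d ℓ hd hL b₀ b₁ Mstar, Fintype (geo9Y x).Site]
  [∀ x : MemberY d ℓ hd hL b₀ b₁ Mstar, DecidableEq (geo9Y x).Site]
variable {c35 : ℝ} {bg : MemberY d ℓ hd hL b₀ b₁ Mstar → B9.Backgrounds}
variable {X Y ι A : MemberY d ℓ hd hL b₀ b₁ Mstar → Type}
  [∀ x, Fintype (X x)] [∀ x, DecidableEq (X x)] [∀ x, Fintype (Y x)] [∀ x, DecidableEq (Y x)] [∀ x, Fintype (ι x)]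
  [∀ x, Fintype (A x)]
variable {ν : ℕ} {Nf : Fin ν → ℕ} [∀ i, NeZero (Nf i)]
variable {E : Type*} [NormedAddCommGroup E] [NormedSpace ℂ E]

/-! ## §1. The real-slice letter of the inverse piece with the margin derived from the real lower bound -/

/-- ★★ **NODE A's REAL-SLICE LETTER FOR THE INVERSE AT ONE MEMBER, THE COMPLEX ACCRETIVITY MARGIN DERIVED** ([B9] Thm 3.4 p. 400 ∕ Sect. B; [II]
p. 15).  Inputs: N06's binders as in 55B (`hc35 q hq H 𝔬A κA hstA hκA h36A` + `h261`); the located reading per member; the member's regime and `α₀`;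
a real structure `ℛ`; a REAL FAMILY of backgrounds `Uv : E → (bg x).Cfg` valued in `Reg335 c₃₅ α₀` on the real slice of the ball `‖·‖ < R_an`; the
complexified operator `A : E → Matrix (X x) (X x) ℂ`, which at every real `v` IS `M((𝔬A x).Δa (Uv v))` (`hslice`), entrywise holomorphic on the ball
(`hA`) with a majorant `Mx` of absolute row ∕ column sums `≤ S` there (`hMx hrow hcol hS`); print's REAL lower bound `hcoer` of `Δ_a` over the class
(3.35) with constant `γ > 0`; the thin radius `0 < R₁ ≤ R_an` with `2S·R₁∕R_an ≤ γ∕2`; `0 < r < 1`.  Then `u ↦ A(u)⁻¹` is a `RawEntryLetters` datum on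
`‖u‖ < (r∕(1+r))R₁` with locations `loc x ∘ (𝔬A x).blk`, rate `(1 − λ(r))·(((1−2q.α)q.δ₀)·sℓ x)`, constant `B^{1−λ(r)}(max B (4∕γ))^{λ(r)}`,
`B = q.C d_q·(ℓmax x)²` — 55B §2 at radius `R₁` with its `hmA ∕ hacc` DISCHARGED (`m_A = γ∕2` by `B13AccretiveOfRealCoercive.accretive_ball_of_realCoercive`).
[cite: Balaban1985BackgroundPropagators, (3.26)–(3.27) p.395, (3.35) p.396, Thm 3.4 p.400, (3.62)–(3.64) p.402, Thm 3.10 (3.105)–(3.108) pp.414–416, Thm 3.11 p.416, p.428;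
Balaban1988RG2Cluster, p.13, p.15; Balaban1987RG1, (1.13)–(1.14) p.262; Ransford1995, Thm. 4.3.7] -/
theorem rawEntryLetters_inv_at_member_realCoercive (hc35 : 0 < c35) (q : PinPrims) (hq : q.OK)
    (H : MemberY d ℓ hd hL b₀ b₁ Mstar → Prop)
    (𝔬A : ∀ x : MemberY d ℓ hd hL b₀ b₁ Mstar, Ops310 (geo9Y x) (bg x) (X x) (Y x) (ι x) (A x))
    (κA : MemberY d ℓ hd hL b₀ b₁ Mstar → Sizes310)
    (hstA : ∀ x, StaticOK310 (𝔬A x) q.ρ q.Nc q.N' q.NF q.Cℓ (κA x)) (hκA : ∀ x, (κA x).Bounded q.Kc)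
    (h36A : ∀ x, q.M₁ ≤ (geo9Y x).M → ∀ α₀ : ℝ, 0 < α₀ → c35 * (geo9Y x).M * α₀ ≤ q.a₁ →
      ∀ U : (bg x).Cfg, (bg x).Reg335 c35 α₀ U →
        Local342G (𝔬A x) 1 (H x) q.B₀ q.δ₀ U ∧ B9Thm310Whole.Factors389 (𝔬A x) 1 (H x) q.θ₀ q.δ₀ U ∧
          Identities310 (𝔬A x) 1 (H x) U)
    {ML : ℝ} (h261 : ∀ x, ML ≤ (geo9Y x).M →
      Ineq261 (exp261 (@geo9Y d ℓ hd hL b₀ b₁ Mstar) q.δ₀ q.α) (toB6 (geo9Y x) 1 (H x)) q.δ₀ q.α)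
    (loc : ∀ x : MemberY d ℓ hd hL b₀ b₁ Mstar, (geo9Y x).Site → UT Nf) (sℓ ℓmax : MemberY d ℓ hd hL b₀ b₁ Mstar → ℝ)
    (hsℓ : ∀ x, 0 ≤ sℓ x) (hloc : ∀ x a b, sℓ x * tdist1 Nf (loc x a) (loc x b) ≤ (geo9Y x).dist a b)
    (hlen : ∀ x a, (geo9Y x).len a ≤ ℓmax x)
    (x : MemberY d ℓ hd hL b₀ b₁ Mstar)
    (hM : max q.M₁ (max ML (max 1 (2 * q.NF * q.θ₀ * B6.c1 (exp261 (@geo9Y d ℓ hd hL b₀ b₁ Mstar) q.δ₀ q.α) q.δ₀ q.α))) ≤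
      (geo9Y x).M)
    {α₀ : ℝ} (hα : 0 < α₀) (ha : (geo9Y x).M * α₀ ≤ q.a₁ / c35)
    -- the real family of backgrounds in the class (3.35) and the complexified `Δ_a` on the configuration ball ([II] p. 15 in-edge)
    (ℛ : RealStructure E) (Uv : E → (bg x).Cfg) {Ran R₁ S γ r : ℝ} {Mx : X x → X x → ℝ}
    (hUv : ∀ v ∈ ℛ.Ereal, ‖v‖ < Ran → (bg x).Reg335 c35 α₀ (Uv v))
    {Aop : E → Matrix (X x) (X x) ℂ}
    (hslice : ∀ v ∈ ℛ.Ereal, ‖v‖ < Ran → Aop v = (LinearMap.toMatrix' ((𝔬A x).Δa (Uv v))).map (algebraMap ℝ ℂ))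
    (hA : ∀ i j, DifferentiableOn ℂ (fun u => Aop u i j) (ball (0 : E) Ran))
    (hMx : ∀ u ∈ ball (0 : E) Ran, ∀ i j, ‖Aop u i j‖ ≤ Mx i j)
    (hrow : ∀ i, ∑ j, Mx i j ≤ S) (hcol : ∀ j, ∑ i, Mx i j ≤ S) (hS : 0 ≤ S)
    -- print's REAL lower bound of `Δ_a` over the class (3.35) ([B9] p. 395 ∕ Thm 3.11 p. 416 ∕ p. 428; N06's lane, displayed)
    (hγ : 0 < γ) (hcoer : ∀ v ∈ ℛ.Ereal, ‖v‖ < Ran → QGQInverse.Coercive (LinearMap.toMatrix' ((𝔬A x).Δa (Uv v))) γ)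
    -- the thin radius ([II] p. 15 «small neighbourhood»; [I] (1.13)–(1.14))
    (hR₁ : 0 < R₁) (hR₁R : R₁ ≤ Ran) (hsmall : 2 * S * R₁ / Ran ≤ γ / 2)
    (hr0 : 0 < r) (hr1 : r < 1) :
    RawEntryLetters (fun u => (Aop u)⁻¹) (loc x ∘ (𝔬A x).blk) (r / (1 + r) * R₁)
      ((1 - lam r) * ((((1 - 2 * q.α) * q.δ₀)) * sℓ x))
      ((q.C (exp261 (@geo9Y d ℓ hd hL b₀ b₁ Mstar) q.δ₀ q.α) * ℓmax x ^ 2) ^ (1 - lam r) *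
        (max (q.C (exp261 (@geo9Y d ℓ hd hL b₀ b₁ Mstar) q.δ₀ q.α) * ℓmax x ^ 2) (4 / γ)) ^ lam r) := by
  -- the real coercive reference at every real configuration of the ball: `A(v) = M(Δ_a(U_v))`, γ-coercive (displayed)
  have hreal : ∀ v ∈ ℛ.Ereal, ‖v‖ < Ran →
      ∃ T₀ : Matrix (X x) (X x) ℝ, Aop v = T₀.map (algebraMap ℝ ℂ) ∧ QGQInverse.Coercive T₀ γ :=
    fun v hv hvR => ⟨_, hslice v hv hvR, hcoer v hv hvR⟩
  -- the perturbative accretivity margin `γ∕2` on the thin ball (module 56A §2, Schwarz lemma)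
  have hacc : ∀ u ∈ ball (0 : E) R₁, ∀ w : X x → ℂ,
      γ / 2 * ∑ i, ‖w i‖ ^ 2 ≤ (∑ i, star (w i) * (Aop u *ᵥ w) i).re := by
    intro u hu w
    have h := accretive_ball_of_realCoercive ℛ hA hMx hrow hcol hS hreal hR₁ hR₁R u hu w
    have hsum : 0 ≤ ∑ i, ‖w i‖ ^ 2 := sum_nonneg fun i _ => by positivity
    have hle : γ / 2 ≤ γ - 2 * S * R₁ / Ran := by linarith
    exact (mul_le_mul_of_nonneg_right hle hsum).trans h
  -- 55B §2 at radius `R₁` with `m_A := γ∕2`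
  have h := rawEntryLetters_inv_at_member_realSlice hc35 q hq H 𝔬A κA hstA hκA h36A h261 loc sℓ ℓmax hsℓ hloc hlen x hM hα ha ℛ Uv
    (fun v hv hvR => hUv v hv (hvR.trans_le hR₁R)) (fun v hv hvR => hslice v hv (hvR.trans_le hR₁R))
    (fun i j => (hA i j).mono (ball_subset_ball hR₁R)) (half_pos hγ) hacc hr0 hr1
  have e : (2 : ℝ) / (γ / 2) = 4 / γ := by
    rw [div_div_eq_mul_div]; ring
  rw [e] at h
  exact h

/-- ★ **RADII EDITION**: the consumer's radius `R₀ > 0` literally (`rf.R` of the junction), the thin radius `R₁ > 2R₀`, the analyticity radius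
`R_an ≥ R₁` ([II] p. 15: «much bigger»), rate loss `λ(R₀∕(R₁ − R₀)) ≤ (4∕π)·R₀∕(R₁ − R₀)`.
[cite: Balaban1985BackgroundPropagators, Thm 3.4 p.400, Thm 3.10 (3.108) p.416, Thm 3.11 p.416, p.428; Balaban1988RG2Cluster, p.15; Balaban1987RG1, (1.13)–(1.14) p.262; Ransford1995, Thm. 4.3.7] -/
theorem rawEntryLetters_inv_at_member_realCoercive_radii (hc35 : 0 < c35) (q : PinPrims) (hq : q.OK)
    (H : MemberY d ℓ hd hL b₀ b₁ Mstar → Prop)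
    (𝔬A : ∀ x : MemberY d ℓ hd hL b₀ b₁ Mstar, Ops310 (geo9Y x) (bg x) (X x) (Y x) (ι x) (A x))
    (κA : MemberY d ℓ hd hL b₀ b₁ Mstar → Sizes310)
    (hstA : ∀ x, StaticOK310 (𝔬A x) q.ρ q.Nc q.N' q.NF q.Cℓ (κA x)) (hκA : ∀ x, (κA x).Bounded q.Kc)
    (h36A : ∀ x, q.M₁ ≤ (geo9Y x).M → ∀ α₀ : ℝ, 0 < α₀ → c35 * (geo9Y x).M * α₀ ≤ q.a₁ →
      ∀ U : (bg x).Cfg, (bg x).Reg335 c35 α₀ U →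
        Local342G (𝔬A x) 1 (H x) q.B₀ q.δ₀ U ∧ B9Thm310Whole.Factors389 (𝔬A x) 1 (H x) q.θ₀ q.δ₀ U ∧
          Identities310 (𝔬A x) 1 (H x) U)
    {ML : ℝ} (h261 : ∀ x, ML ≤ (geo9Y x).M →
      Ineq261 (exp261 (@geo9Y d ℓ hd hL b₀ b₁ Mstar) q.δ₀ q.α) (toB6 (geo9Y x) 1 (H x)) q.δ₀ q.α)
    (loc : ∀ x : MemberY d ℓ hd hL b₀ b₁ Mstar, (geo9Y x).Site → UT Nf) (sℓ ℓmax : MemberY d ℓ hd hL b₀ b₁ Mstar → ℝ)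
    (hsℓ : ∀ x, 0 ≤ sℓ x) (hloc : ∀ x a b, sℓ x * tdist1 Nf (loc x a) (loc x b) ≤ (geo9Y x).dist a b)
    (hlen : ∀ x a, (geo9Y x).len a ≤ ℓmax x)
    (x : MemberY d ℓ hd hL b₀ b₁ Mstar)
    (hM : max q.M₁ (max ML (max 1 (2 * q.NF * q.θ₀ * B6.c1 (exp261 (@geo9Y d ℓ hd hL b₀ b₁ Mstar) q.δ₀ q.α) q.δ₀ q.α))) ≤
      (geo9Y x).M)
    {α₀ : ℝ} (hα : 0 < α₀) (ha : (geo9Y x).M * α₀ ≤ q.a₁ / c35)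
    (ℛ : RealStructure E) (Uv : E → (bg x).Cfg) {Ran R₁ R₀ S γ : ℝ} {Mx : X x → X x → ℝ}
    (hUv : ∀ v ∈ ℛ.Ereal, ‖v‖ < Ran → (bg x).Reg335 c35 α₀ (Uv v))
    {Aop : E → Matrix (X x) (X x) ℂ}
    (hslice : ∀ v ∈ ℛ.Ereal, ‖v‖ < Ran → Aop v = (LinearMap.toMatrix' ((𝔬A x).Δa (Uv v))).map (algebraMap ℝ ℂ))
    (hA : ∀ i j, DifferentiableOn ℂ (fun u => Aop u i j) (ball (0 : E) Ran))
    (hMx : ∀ u ∈ ball (0 : E) Ran, ∀ i j, ‖Aop u i j‖ ≤ Mx i j)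
    (hrow : ∀ i, ∑ j, Mx i j ≤ S) (hcol : ∀ j, ∑ i, Mx i j ≤ S) (hS : 0 ≤ S)
    (hγ : 0 < γ) (hcoer : ∀ v ∈ ℛ.Ereal, ‖v‖ < Ran → QGQInverse.Coercive (LinearMap.toMatrix' ((𝔬A x).Δa (Uv v))) γ)
    (hR₀ : 0 < R₀) (h2 : 2 * R₀ < R₁) (hR₁R : R₁ ≤ Ran) (hsmall : 2 * S * R₁ / Ran ≤ γ / 2) :
    RawEntryLetters (fun u => (Aop u)⁻¹) (loc x ∘ (𝔬A x).blk) R₀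
      ((1 - lam (R₀ / (R₁ - R₀))) * ((((1 - 2 * q.α) * q.δ₀)) * sℓ x))
      ((q.C (exp261 (@geo9Y d ℓ hd hL b₀ b₁ Mstar) q.δ₀ q.α) * ℓmax x ^ 2) ^ (1 - lam (R₀ / (R₁ - R₀))) *
        (max (q.C (exp261 (@geo9Y d ℓ hd hL b₀ b₁ Mstar) q.δ₀ q.α) * ℓmax x ^ 2) (4 / γ)) ^ lam (R₀ / (R₁ - R₀))) ∧
      lam (R₀ / (R₁ - R₀)) ≤ 4 / Real.pi * (R₀ / (R₁ - R₀)) := by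
  have hd' : 0 < R₁ - R₀ := by linarith
  have hR₁ : 0 < R₁ := by linarith
  have hr0 : 0 < R₀ / (R₁ - R₀) := div_pos hR₀ hd'
  have hr1 : R₀ / (R₁ - R₀) < 1 := (div_lt_one hd').2 (by linarith)
  have h := rawEntryLetters_inv_at_member_realCoercive hc35 q hq H 𝔬A κA hstA hκA h36A h261 loc sℓ ℓmax hsℓ hloc hlen x hM hα ha ℛ Uv
    hUv hslice hA hMx hrow hcol hS hγ hcoer hR₁ hR₁R hsmall hr0 hr1
  have e : R₀ / (R₁ - R₀) / (1 + R₀ / (R₁ - R₀)) * R₁ = R₀ := by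
    field_simp
    ring
  rw [e] at h
  exact ⟨h, lam_radii_le hR₀.le h2⟩

end Summit.QuantumFields.YangMills.BalabanUVNodes.N10EntryLettersOfN06RecordFaceB

end
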